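import Summits.ResolutionOfSingularities.ResolutionOfSingularities.Theorems.EquisingularLiftEquisingularLiftNatFatCentre
import Summits.ResolutionOfSingularities.ResolutionOfSingularities.Theorems.EquisingularLiftEquisingularLiftNatModelStep
import Literature.AlgebraicGeometry.Resolution.BlowupsExistence
import HarnessLib

/-!
# [OURS · L1 W4.5(b) · EL♮(3)] T-FATCENTRE, part 2: THE FAT-POINT STEP at stage level — centre ∘ blow-up ∘ model square
# (`exists_fatCentre` p545966 ∘ res-D-pv-029's `modelStep` p509016), Member-free

Crux chain w45b (cell `res-hironaka`, slot W4.5(b)), working crux **EL♮** = stmt-ResolutionOfSingularities-20038, child **EL♮(3)** =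
stmt-ResolutionOfSingularities-20148, route EquisingularLift, line `sections`, registered stub `stub_elnat_towerPointResolution` (rung TOWER);
upstairs debt HSUB′(ReachTower)₃, the (pt-ram) constructor `TowerPtRam` of …NatTowerDefs (p541504). HONEST FRAMING: OURS; NOT a statement
of any manuscript; AI-written, weaker than expert review. No `sorry`; standard axioms. DEF-FREE. `--supports stmt-ResolutionOfSingularities-20148 --as helper`.

WHAT. **`fatPointStep`** — in the binders of the K-kit's model step (a `Ch`-stage `(X', σ', S')` over the proper `q : P → Spec O`, the model
square `j : F → X'` over `Spec θ`, `j '' T = S'`) and of `TowerPtRam` (a closed point `y ∈ T` with `𝒪_{X',j y}` of dimension `n + 1`, a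
curvilinear fat point `J` at `y`: `supp J = {y}`, `J_y = (ℓ)`, cotangent-independent `ℓ`, and the downstairs blow-up `υ : F₂ → F` of `J`),
with `σ' (j y)` not a generic point of `Y` and `Y` inside the special fibre: THERE ARE the centre `C` (T-FATCENTRE: regular, `O`-flat, meeting
the special fibre in `j y` only, `C·𝒪_F = J`), a blow-up `τ : X'' → X'` of `X'` along `C` (tree `exists_isBlowup`), and a model square
`j₂ : F₂ → X''` over `Spec θ` with `j₂ ≫ τ = υ ≫ j`, such that `(X'', τ ≫ σ', closure τ⁻¹(S' ∖ supp C))` is again a `Ch`-stage, regular and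
locally Noetherian, and `j₂ '' closure υ⁻¹(T ∖ {y})` is its running set — ONE application of `exists_fatCentre` and ONE of `modelStep`.
The HSUB′(ReachTower) assembly plugs its `TowerPtRam` clause into this theorem (Member packaging aside).

References (index only): res-D-pv-029 `modelStep` (…NatModelStep, p509016); T-FATCENTRE (…NatFatCentre, p545966); …NatTowerDefs (`TowerPtRam`).
-/

set_option linter.dupNamespace false -- mandated namespace `Summit.<Summit>.<Problem>` of this single-conjunct summit
set_option linter.overlappingInstances false -- the binders carry `[IsDomain O] [IsDiscreteValuationRing O]`

noncomputable section

open CategoryTheory CategoryTheory.Limits AlgebraicGeometry TopologicalSpace Topology IsLocalRing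
open Literature.AlgebraicGeometry.Resolution
open AlgebraicGeometry.Scheme.IdealSheafData

namespace Summit.ResolutionOfSingularities.ResolutionOfSingularities.Cruxes.EquisingularLiftNat.Sections

/-- **THE FAT-POINT STEP at stage level** (see the module docstring): the `TowerPtRam` data at a closed point `y` of the running set give
an upstairs centre `C` with `C·𝒪_F = J`, a blow-up `τ` of the stage along `C`, and the model square of the new stage over the downstairs
blow-up `υ` of the fat point `J`, with the new stage again a regular locally Noetherian `Ch`-stage.
[cite: Matsumura1987, Thm. 14.2; StacksProject, Tag 0805] [OURS · L1 W4.5b · T-FATCENTRE part 2] -/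
theorem fatPointStep (O : Type) [CommRing O] [IsDomain O] [IsDiscreteValuationRing O] [IsAdicComplete (maximalIdeal O) O]
    [IsAlgClosed (ResidueField O)] (k : Type) [Field k] (θ : O →+* k) (hθ : Function.Surjective θ)
    (P : Scheme.{0}) (q : P ⟶ Spec (.of O)) (Y : Set P) (hYsp : Y ⊆ q ⁻¹' {closedPoint O})
    (Ch : ∀ X' : Scheme.{0}, (X' ⟶ P) → Set X' → Prop)
    (hStep : ∀ (X' X'' : Scheme.{0}) (σ' : X' ⟶ P) (S' : Set X') (C : X'.IdealSheafData) (τ : X'' ⟶ X'),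
      Ch X' σ' S' → IsBlowup τ C → Scheme.IsRegular C.subscheme → Flat (C.subschemeι ≫ σ' ≫ q) →
      σ' '' (C.support : Set X') ⊆ {x : P | ¬ IsGenericPoint x Y} →
      (C.support : Set X') ∩ (σ' ≫ q) ⁻¹' {IsLocalRing.closedPoint O} ⊆ S' →
      Ch X'' (τ ≫ σ') (closure (τ ⁻¹' (S' \ (C.support : Set X')))))
    -- the upstairs stage
    (X' : Scheme.{0}) (σ' : X' ⟶ P) (S' : Set X') (hCh : Ch X' σ' S')
    [IsLocallyNoetherian X'] (hreg : Scheme.IsRegular X') (hprop : IsProper (σ' ≫ q))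
    -- the downstairs stage and the model square
    (F : Scheme.{0}) (j : F ⟶ X') (t : F ⟶ Spec (.of k))
    (hsq : IsPullback j t (σ' ≫ q) (Spec.map (CommRingCat.ofHom θ)))
    (T : Set F) (hTS : j '' T = S')
    -- the fat point (`TowerPtRam`)
    (y : F) (hyc : IsClosed ({y} : Set F)) (hyT : y ∈ T) {n : ℕ}
    (hdim : ringKrullDim (X'.presheaf.stalk (j y)) = ((n + 1 : ℕ) : WithBot ℕ∞))
    (hyoff : ¬ IsGenericPoint (σ' (j y)) Y)
    (J : F.IdealSheafData) (hJsupp : (J.support : Set F) = {y})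
    (ℓ : Fin n → F.presheaf.stalk y) (hℓ : ∀ i, ℓ i ∈ maximalIdeal (F.presheaf.stalk y))
    (hJℓ : stalkIdeal J y = Ideal.span (Set.range ℓ))
    (hli : LinearIndependent (ResidueField (F.presheaf.stalk y)) fun i => (maximalIdeal (F.presheaf.stalk y)).toCotangent ⟨ℓ i, hℓ i⟩)
    -- the downstairs blow-up of the fat point
    (F₂ : Scheme.{0}) (υ : F₂ ⟶ F) (hυ : IsBlowup υ J) :
    ∃ (C : X'.IdealSheafData) (X'' : Scheme.{0}) (τ : X'' ⟶ X') (j₂ : F₂ ⟶ X'') (t₂ : F₂ ⟶ Spec (.of k)),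
      IsBlowup τ C ∧ C.comap j = J ∧ Scheme.IsRegular C.subscheme ∧ AlgebraicGeometry.IsIntegral C.subscheme ∧
      Flat (C.subschemeι ≫ σ' ≫ q) ∧
      (C.support : Set X') ∩ (σ' ≫ q) ⁻¹' {closedPoint O} = {j y} ∧
      Ch X'' (τ ≫ σ') (closure (τ ⁻¹' (S' \ (C.support : Set X')))) ∧
      Scheme.IsRegular X'' ∧ IsLocallyNoetherian X'' ∧
      IsPullback j₂ t₂ ((τ ≫ σ') ≫ q) (Spec.map (CommRingCat.ofHom θ)) ∧ j₂ ≫ τ = υ ≫ j ∧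
      j₂ '' closure (υ ⁻¹' (T \ {y})) = closure (τ ⁻¹' (S' \ (C.support : Set X'))) := by
  haveI := hprop
  -- (1) T-FATCENTRE
  obtain ⟨C, ℓ', hint, hCreg, hflat, hsf, -, -, hCJ⟩ :=
    exists_fatCentre O k θ hθ (σ' ≫ q) j t hsq y hyc (hreg (j y)) hdim J hJsupp ℓ hℓ hJℓ hli
  -- (2) a blow-up of the stage along `C`
  obtain ⟨X'', τ, hτ⟩ := exists_isBlowup X' C
  -- (3) the `Ch`-step inputs
  have hflat' : Flat (C.subschemeι ≫ σ' ≫ q) := by simpa only [Category.assoc] using hflat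
  have hoff : σ' '' (C.support : Set X') ⊆ {x : P | ¬ IsGenericPoint x Y} := by
    rintro _ ⟨x, hx, rfl⟩ hgen
    have hxY : σ' x ∈ Y := hgen.mem
    have hxs : (σ' ≫ q) x = closedPoint O := by
      rw [Scheme.Hom.comp_apply]; exact hYsp hxY
    have hxy : x = j y := by
      have h : x ∈ (C.support : Set X') ∩ (σ' ≫ q) ⁻¹' {closedPoint O} := ⟨hx, hxs⟩
      rw [hsf] at h
      exact h
    subst hxy
    exact hyoff hgen
  have hDT : (J.support : Set F) ⊆ T := by
    rw [hJsupp, Set.singleton_subset_iff]; exact hyT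
  -- (4) the model step
  obtain ⟨hCh'', hreg'', hnoeth'', j₂, t₂, hsq₂, hcomm, himg⟩ :=
    modelStep O k θ hθ P q Y Ch hStep X' σ' S' hCh hreg F j t hsq T hTS C J hCJ hCreg hflat' hoff hDT X'' τ hτ F₂ υ hυ
  refine ⟨C, X'', τ, j₂, t₂, hτ, hCJ, hCreg, hint, hflat', hsf, hCh'', hreg'', hnoeth'', hsq₂, hcomm, ?_⟩
  rw [← himg, hJsupp]

end Summit.ResolutionOfSingularities.ResolutionOfSingularities.Cruxes.EquisingularLiftNat.Sections

end
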